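import Literature.AlgebraicGeometry.HodgeTheory.ComplexTorusIntegralHodgeClassesCorrespondenceOfMorphism
import Literature.AlgebraicGeometry.HodgeTheory.ComplexTorusIntegralHodgeClassesCorrespondenceFunctoriality
import HarnessLib

/-!
# Multiplication correspondences `Δ_*(u)` on `Hdg•(X × X, ℤ)` for a complex torus (Fulton §16.1, Example 16.1.14 (ii))

For a complex torus `X` and an integral Hodge class `u ∈ Hdgᶜ(X, ℤ)` the MULTIPLICATION CORRESPONDENCE of `u` is the push-forward
`Δ_*(u) ∈ Hdg^{c+g}(X × X, ℤ)` (`g = dim X`) along the diagonal `Δ : X → X × X` (g27-#2 `integralHodgeClassesPushforward`, any codimension; for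
`u = 1_X` it is the diagonal class `[Δ_X] = Δ_*(1_X)`, the unit of the ring of correspondences, g27-#5 / g33-#1). This file proves, on the
integral carriers `Hdg•(−, ℤ)` of complex tori and in the explicit-frame conventions of g27–g33 (composite `β ∘ α = p₁₃_*(p₁₂^*α · p₂₃^*β)` computed on
`X × (Y × Z)`, `α_*(a) = p_{2*}(α · p₁^*a)`, `α^*(b) = p_{1*}(α · p₂^*b)`):

* §0 `(1_X × Δ_Y) ≫ p₁₂ = (1_X × Δ_Y) ≫ p₁₃ = 1_{X × Y}` — Fulton's identities "`p_{XY}(1_X × γ_g) = 1_{X×Y}`, `p_{XZ}(1_X × γ_g) = 1_X × g`" for `g = Δ`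
  [cite: Fulton1998, §16.1 Prop. 16.1.1 (c) proof (p0294 L26–L28)];
* §1 `Δ_*(u) = [Δ_X] · p₁^*u = [Δ_X] · p₂^*u` — Fulton's "if `i` is the imbedding of `T` in `X × Y`, then `i_*(p^*a) = T · (a × Y)`" for `T = Δ_X`
  [cite: Fulton1998, §16.1 Example 16.1.14 (ii) (p0302 L14–L20)], i.e. the projection formula `Δ_*(Δ^*w) = Δ_*(1) · w`
  [cite: Fulton1998, Prop. 8.3 (c) (p0132 L46–L48)] [cite: Lange2023AbelianVarietiesComplex, §6.2.1 Thm. 6.2.4 (p0302 L17–L19)]; and `Δ_*(u)′ = Δ_*(u)`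
  (`Δ ≫ τ = Δ`) [cite: Fulton1998, §16.1 Cor. 16.1.1 (p0295 L7)] [cite: HatcherAT2002, §3.B (p0360 L10)];
* §2 `(Δ_*u)_*(a) = u · a` and `(Δ_*u)^*(b) = u · b` (Def. 16.1.2's `α_*`, `α^*` [cite: Fulton1998, §16.1 Def. 16.1.2 (p0295 L9–L15)]): the
  correspondence `Δ_*(u)` INDUCES MULTIPLICATION BY `u` — g28-#10 `integralHodgeClassesCorrAct_pushforward` ("`T_*(a) = q_*(ζ · p^*a)`" for `T = j_*ζ`)
  at `j = Δ`, `Δ ≫ p₁ = Δ ≫ p₂ = 1_X`. In particular for `θ ∈ Hdg¹(X, ℤ)` the LEFSCHETZ OPERATOR `L_θ = θ · (−)` is induced by the INTEGRAL Hodge class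
  `Δ_*θ ∈ Hdg^{g+1}(X × X, ℤ)` ("L is induced by an algebraic correspondence" [cite: CattaniElZeinGriffithsLe2014, Ch. 11 §11.2 (p0471 L25)]; "algebraic,
  i.e., is induced by an algebraic cycle on `X × X`" [cite: GreenMurreVoisin1994, Murre Ch. 7 §7.7 (p0122 L19–L30)]);
* §3 `Δ_*(v) ∘ α = α · p₂^*v` for EVERY correspondence `α ∈ Hdgᵃ(X × Y, ℤ)` and `v ∈ Hdgᶜ(Y, ℤ)` — Fulton's proof of Prop. 16.1.1 (c)(i)
  (`Γ_g ∘ α = (1_X × g)_*α`) with the graph `γ_g` replaced by `Δ_Y`: base change `p₂₃^*(Δ_*v) = (1_X × Δ)_*(p₂^*v)` (g27-#8), the projection formula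
  for `1_X × Δ`, and §0 [cite: Fulton1998, §16.1 Prop. 16.1.1 (c)(i) and proof (p0293 L24; p0294 L21–L28)];
* §4 `Δ_*(w) ∘ Δ_*(u) = Δ_*(u · w)`: `u ↦ Δ_*(u)` is MULTIPLICATIVE from the cup-product ring `Hdg•(X, ℤ)` to the ring of correspondences
  `(Hdg•(X × X, ℤ), ∘)` (unit `[Δ_X] = Δ_*(1_X)`, g27-#5, g33-#1) [cite: Fulton1998, §16.1 Cor. 16.1.1 (p0295 L7) and Example 16.1.14 (ii) (p0302 L14–L20)].

Everything is a theorem (no definition, no named fact, D-0026); frames are arbitrary and explicit as in g27–g33; `X × Y` is `prodObj X Y`.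

## References

* [Fulton1998] W. Fulton, Intersection Theory, 2nd ed., Springer 1998 — §16.1 (pp. 305–315 of the book; PDF p0293–p0305), Prop. 8.3 (c).
* [Lange2023AbelianVarietiesComplex] H. Lange, Abelian Varieties over the Complex Numbers, Springer 2023 — §6.2.1 Thm. 6.2.4, Thm. 6.2.5.
* [CattaniElZeinGriffithsLe2014] E. Cattani, F. El Zein, P. Griffiths, Lê D. T. (eds.), Hodge Theory, Princeton Math. Notes 49, 2014 — Ch. 11
  (F. Charles, C. Schnell, Notes on absolute Hodge classes) §11.2.
* [GreenMurreVoisin1994] M. Green, J. Murre, C. Voisin, Algebraic Cycles and Hodge Theory (CIME Torino 1993), LNM 1594, 1994 — Murre Ch. 7 §7.7.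
* [HatcherAT2002] A. Hatcher, Algebraic Topology, CUP 2002 — §3.B.
-/

noncomputable section

open CategoryTheory Function

namespace Literature.AlgebraicGeometry.HodgeTheory

open Literature.AlgebraicGeometry.Motives Literature.AlgebraicGeometry.Motives.HodgeStructure
open Literature.Geometry.Kaehler Literature.Geometry.Kaehler.ComplexTorus

namespace ComplexTorusCat

/-! ## §0 `(1_X × Δ_Y) ≫ p₁₂ = 1` and `(1_X × Δ_Y) ≫ p₁₃ = 1` on `X × Y → X × (Y × Y)` -/

section Plumbing

variable (X Y : ComplexTorusCat)

/-- `(1_X × Δ_Y) ≫ p₁₂ = 1_{X × Y}` (`p₁₂ = (p₁, p₁p₂)` on `X × (Y × Y)`). [cite: Fulton1998, §16.1 Prop. 16.1.1 (c) proof (p0294 L26–L28: "p_{XY}(1_X × γ_g) = 1_{X×Y}")] -/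
theorem prodMap_id_diagHom_comp_liftHom_fst_sndfst :
    prodMap (𝟙 X) (diagHom Y) ≫ liftHom (fstHom X (prodObj Y Y)) (sndHom X (prodObj Y Y) ≫ fstHom Y Y) = 𝟙 (prodObj X Y) := by
  refine prod_hom_ext ?_ ?_ <;> simp [diagHom_fstHom]

/-- `(1_X × Δ_Y) ≫ p₁₃ = 1_{X × Y}` (`p₁₃ = (p₁, p₂p₂)`). [cite: Fulton1998, §16.1 Prop. 16.1.1 (c) proof (p0294 L26–L28: "p_{XZ}(1_X × γ_g) = 1_X × g")] -/
theorem prodMap_id_diagHom_comp_liftHom_fst_sndsnd :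
    prodMap (𝟙 X) (diagHom Y) ≫ liftHom (fstHom X (prodObj Y Y)) (sndHom X (prodObj Y Y) ≫ sndHom Y Y) = 𝟙 (prodObj X Y) := by
  refine prod_hom_ext ?_ ?_ <;> simp [diagHom_sndHom]

end Plumbing

/-! ## §1 `Δ_*(u) = [Δ_X] · p₁^*u = [Δ_X] · p₂^*u` -/

section Diagonal

variable (X : ComplexTorusCat) {gX gXX : ℕ} (eX : Fin (2 * gX) ≃ X.toIsog.ι) (eXX : Fin (2 * gXX) ≃ (prodObj X X).toIsog.ι)
  (hX : 2 * gX + 2 * 0 = 2 * gX) (hgX : gX + gX = 2 * gX) (hcX : 2 * gX + 2 * gX = 2 * gXX) (hgXX : gXX + gXX = 2 * gXX)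
  {c c' l : ℕ} (hc' : gX + c = c') (hl : l + 2 * c = 2 * gX) (hl' : l + 2 * c' = 2 * gXX)

/-- **`Δ_*(u) = [Δ_X] · p₁^*u`** for `u ∈ Hdgᶜ(X, ℤ)`: the MULTIPLICATION CORRESPONDENCE of `u` — the push-forward of `u` along the diagonal `Δ : X → X × X` (g27-#2,
any codimension) — is the class of the diagonal cut by `p₁^*u` (Fulton's "if `i` is the imbedding of `T` in `X × Y`, then `i_*(p^*a) = T · (a × Y)`" for `T = Δ_X`,
`i = δ`, `p = 1_X`): the projection formula `Δ_*(Δ^*w) = Δ_*(1) · w` (g27-#2 `integralHodgeClassesPushforward_pullbackHom`) at `w = p₁^*u`, `Δ ≫ p₁ = 1`.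
[cite: Fulton1998, §16.1 Example 16.1.14 (ii) (p0302 L14–L20) and Prop. 8.3 (c) (p0132 L46–L48)] [cite: Lange2023AbelianVarietiesComplex, §6.2.1 Thm. 6.2.4 (p0302 L17–L19)] -/
theorem integralHodgeClassesPushforward_diagHom_eq_diagonalClass_cup_pullbackHom_fstHom (u : integralHodgeClasses X.toIsog.Φ c) :
    integralHodgeClassesPushforward c c' (diagHom X) eX eXX hl hgX hl' hgXX u =
      integralHodgeClassesCup (prodObj X X).toIsog.Φ hc'
          (integralHodgeClassesPushforward 0 gX (diagHom X) eX eXX hX hgX hcX hgXX (unitIntegralHodgeClass X))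
          (integralHodgeClassesPullbackHom (fstHom X X) c u) := by
  rw [← integralHodgeClassesPushforward_pullbackHom (diagHom X) eX eXX hgX hgXX hc' hX hcX hl hl', ← integralHodgeClassesPullbackHom_comp, diagHom_fstHom,
    integralHodgeClassesPullbackHom_id]

/-- **`Δ_*(u) = [Δ_X] · p₂^*u`** likewise (`Δ ≫ p₂ = 1`). [cite: Fulton1998, §16.1 Example 16.1.14 (ii) (p0302 L14–L20) and Prop. 8.3 (c) (p0132 L46–L48)] -/
theorem integralHodgeClassesPushforward_diagHom_eq_diagonalClass_cup_pullbackHom_sndHom (u : integralHodgeClasses X.toIsog.Φ c) :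
    integralHodgeClassesPushforward c c' (diagHom X) eX eXX hl hgX hl' hgXX u =
      integralHodgeClassesCup (prodObj X X).toIsog.Φ hc'
          (integralHodgeClassesPushforward 0 gX (diagHom X) eX eXX hX hgX hcX hgXX (unitIntegralHodgeClass X))
          (integralHodgeClassesPullbackHom (sndHom X X) c u) := by
  rw [← integralHodgeClassesPushforward_pullbackHom (diagHom X) eX eXX hgX hgXX hc' hX hcX hl hl', ← integralHodgeClassesPullbackHom_comp, diagHom_sndHom,
    integralHodgeClassesPullbackHom_id]

/-- **`Δ_*(u)′ = Δ_*(u)`**: multiplication correspondences are symmetric (`Δ ≫ τ = Δ`; the transpose `τ_*` of g27-#6, written from the frame `eXX` to any frame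
`eXX′`). [cite: Fulton1998, §16.1 Cor. 16.1.1 (p0295 L7: "with an involution α → α′")] [cite: HatcherAT2002, §3.B (p0360 L10: "TΔ = Δ")] -/
theorem integralHodgeClassesPushforward_swapHom_pushforward_diagHom (eXX' : Fin (2 * gXX) ≃ (prodObj X X).toIsog.ι) {l'' : ℕ} (hq : l'' + 2 * c' = 2 * gXX)
    (u : integralHodgeClasses X.toIsog.Φ c) :
    integralHodgeClassesPushforward c' c' (swapHom X X) eXX eXX' hq hgXX hq hgXX (integralHodgeClassesPushforward c c' (diagHom X) eX eXX hl hgX hl' hgXX u) =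
      integralHodgeClassesPushforward c c' (diagHom X) eX eXX' hl hgX hl' hgXX u := by
  obtain rfl : l'' = l := by omega
  rw [← integralHodgeClassesPushforward_comp, diagHom_swapHom]

end Diagonal

/-! ## §2 The action: `(Δ_*u)_*(a) = u · a`, `(Δ_*u)^*(b) = u · b` -/

section Action

variable (X : ComplexTorusCat) {gX gXX : ℕ} (eX : Fin (2 * gX) ≃ X.toIsog.ι) (eXX : Fin (2 * gXX) ≃ (prodObj X X).toIsog.ι)
  (hgX : gX + gX = 2 * gX) (hgXX : gXX + gXX = 2 * gXX) {c c' l : ℕ} (hl : l + 2 * c = 2 * gX) (hl' : l + 2 * c' = 2 * gXX)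
  {p s t m : ℕ} (hs : c' + p = s) (ht : c + p = t) (hm : m + 2 * s = 2 * gXX) (hm' : m + 2 * t = 2 * gX)

/-- **`(Δ_*u)_*(a) = u · a`: THE CORRESPONDENCE `Δ_*(u)` INDUCES MULTIPLICATION BY `u`** — `p_{2*}(Δ_*u · p₁^*a) = u · a` for `u ∈ Hdgᶜ(X, ℤ)`, `a ∈ Hdgᵖ(X, ℤ)`
(Def. 16.1.2's `α_*`): Fulton's `T_*(a) = q_*(ζ · p^*a)` for the correspondence `j_*ζ` carried by `j = Δ` (g28-#10 `integralHodgeClassesCorrAct_pushforward`) with `Δ ≫ p₁ =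
Δ ≫ p₂ = 1_X`. For `u = θ = c₁(L) ∈ Hdg¹(X, ℤ)` this is the LEFSCHETZ OPERATOR `L_θ = θ · (−)`: "L is induced by an algebraic correspondence", here by the integral
Hodge class `Δ_*θ ∈ Hdg^{g+1}(X × X, ℤ)`. [cite: Fulton1998, §16.1 Example 16.1.14 (ii) (p0302 L14–L20) and Def. 16.1.2 (p0295 L9–L13)]
[cite: CattaniElZeinGriffithsLe2014, Ch. 11 §11.2 (p0471 L25: "L is induced by an algebraic correspondence")] -/
theorem integralHodgeClassesPushforward_sndHom_pushforward_diagHom_cup_pullbackHom_fstHom (u : integralHodgeClasses X.toIsog.Φ c)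
    (a : integralHodgeClasses X.toIsog.Φ p) :
    integralHodgeClassesPushforward s t (sndHom X X) eXX eX hm hgXX hm' hgX
        (integralHodgeClassesCup (prodObj X X).toIsog.Φ hs
          (integralHodgeClassesPushforward c c' (diagHom X) eX eXX hl hgX hl' hgXX u)
          (integralHodgeClassesPullbackHom (fstHom X X) p a)) =
      integralHodgeClassesCup X.toIsog.Φ ht u a := by
  rw [integralHodgeClassesCorrAct_pushforward (diagHom X) eX eX eXX hgX hgX hgXX hl hl' hs ht hm hm' hm' hm' u a, diagHom_sndHom,
    integralHodgeClassesPushforward_id, diagHom_fstHom, integralHodgeClassesPullbackHom_id]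

/-- **`(Δ_*u)^*(b) = u · b`** likewise: `p_{1*}(Δ_*u · p₂^*b) = u · b` (Def. 16.1.2's `α^*`; g28-#10 `integralHodgeClassesCorrCoact_pushforward` at `j = Δ`).
[cite: Fulton1998, §16.1 Example 16.1.14 (ii) (p0302 L14–L20) and Def. 16.1.2 (p0295 L13–L15)] [cite: CattaniElZeinGriffithsLe2014, Ch. 11 §11.2 (p0471 L25)] -/
theorem integralHodgeClassesPushforward_fstHom_pushforward_diagHom_cup_pullbackHom_sndHom (u : integralHodgeClasses X.toIsog.Φ c)
    (b : integralHodgeClasses X.toIsog.Φ p) :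
    integralHodgeClassesPushforward s t (fstHom X X) eXX eX hm hgXX hm' hgX
        (integralHodgeClassesCup (prodObj X X).toIsog.Φ hs
          (integralHodgeClassesPushforward c c' (diagHom X) eX eXX hl hgX hl' hgXX u)
          (integralHodgeClassesPullbackHom (sndHom X X) p b)) =
      integralHodgeClassesCup X.toIsog.Φ ht u b := by
  rw [integralHodgeClassesCorrCoact_pushforward (diagHom X) eX eX eXX hgX hgX hgXX hl hl' hs ht hm hm' hm' hm' u b, diagHom_fstHom,
    integralHodgeClassesPushforward_id, diagHom_sndHom, integralHodgeClassesPullbackHom_id]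

end Action

/-! ## §3 Composition with a multiplication correspondence: `Δ_*(v) ∘ α = α · p₂^*v` -/

section CompRight

variable {X Y : ComplexTorusCat} {gX gY gXY gYY gT : ℕ} (eX : Fin (2 * gX) ≃ X.toIsog.ι) (eY : Fin (2 * gY) ≃ Y.toIsog.ι)
  (eXY : Fin (2 * gXY) ≃ (prodObj X Y).toIsog.ι) (eYY : Fin (2 * gYY) ≃ (prodObj Y Y).toIsog.ι) (eT : Fin (2 * gT) ≃ (prodObj X (prodObj Y Y)).toIsog.ι)
  (hN : 2 * gX + 2 * gY = 2 * gXY) (hN' : 2 * gX + 2 * gYY = 2 * gT) (hgY : gY + gY = 2 * gY) (hgXY : gXY + gXY = 2 * gXY) (hgYY : gYY + gYY = 2 * gYY)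
  (hgT : gT + gT = 2 * gT) {a c c' ac K l l₃ : ℕ} (hac : a + c = ac) (hK : a + c' = K) (hl : l + 2 * c = 2 * gY) (hl' : l + 2 * c' = 2 * gYY)
  (h3 : l₃ + 2 * K = 2 * gT) (h3' : l₃ + 2 * ac = 2 * gXY)

include eX hN hN' in
/-- **`Δ_*(v) ∘ α = α · p₂^*v` for every correspondence `α ∈ Hdgᵃ(X × Y, ℤ)` and `v ∈ Hdgᶜ(Y, ℤ)`** — `p₁₃_*(p₁₂^*α · p₂₃^*(Δ_{Y*}v)) = α · p₂^*v` in `Hdg^{a+c}(X × Y, ℤ)`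
(composite on `X × (Y × Y)`, g27-#5's convention): post-composing with the multiplication correspondence of `v` multiplies by `p₂^*v`. Fulton's argument for
`Γ_g ∘ α` (Prop. 16.1.1 (c)(i)) with `γ_g` replaced by `Δ`: `p₂₃^*(Δ_*v) = (1_X × Δ)_*(p₂^*v)` (base change, g27-#8
`integralHodgeClassesPushforward_id_prodMap_pullbackHom_sndHom'`), the projection formula for `1_X × Δ` (g27-#2), and `(1_X × Δ) ≫ p₁₂ = (1_X × Δ) ≫ p₁₃ = 1` (§0).
[cite: Fulton1998, §16.1 Prop. 16.1.1 (c)(i) with proof (p0293 L24; p0294 L21–L28) and Example 16.1.14 (ii) (p0302 L14–L20)]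
[cite: Lange2023AbelianVarietiesComplex, §6.2.1 Thm. 6.2.4, Thm. 6.2.5 (p0302) and §6.2.2 (p0303 L40–L42)] -/
theorem integralHodgeClassesCorrComp_pushforward_diagHom_right (α : integralHodgeClasses (prodObj X Y).toIsog.Φ a) (v : integralHodgeClasses Y.toIsog.Φ c) :
    integralHodgeClassesPushforward K ac (liftHom (fstHom X (prodObj Y Y)) (sndHom X (prodObj Y Y) ≫ sndHom Y Y)) eT eXY h3 hgT h3' hgXY
        (integralHodgeClassesCup (prodObj X (prodObj Y Y)).toIsog.Φ hK
          (integralHodgeClassesPullbackHom (liftHom (fstHom X (prodObj Y Y)) (sndHom X (prodObj Y Y) ≫ fstHom Y Y)) a α)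
          (integralHodgeClassesPullbackHom (sndHom X (prodObj Y Y)) c' (integralHodgeClassesPushforward c c' (diagHom Y) eY eYY hl hgY hl' hgYY v))) =
      integralHodgeClassesCup (prodObj X Y).toIsog.Φ hac α (integralHodgeClassesPullbackHom (sndHom X Y) c v) := by
  rw [← integralHodgeClassesPushforward_id_prodMap_pullbackHom_sndHom' (diagHom Y) X eY eYY hl hgY hl' hgYY eX eXY eT hN hN' (by omega) hgXY (by omega) hgT,
    ← integralHodgeClassesPushforward_pullbackHom_cup (prodMap (𝟙 X) (diagHom Y)) eXY eT hgXY hgT (show (2 * gX + l) + 2 * c = 2 * gXY by omega)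
      (show (2 * gX + l) + 2 * c' = 2 * gT by omega) h3' h3 hac hK,
    ← integralHodgeClassesPushforward_comp, ← integralHodgeClassesPullbackHom_comp, prodMap_id_diagHom_comp_liftHom_fst_sndfst,
    prodMap_id_diagHom_comp_liftHom_fst_sndsnd, integralHodgeClassesPullbackHom_id, integralHodgeClassesPushforward_id]

end CompRight

/-! ## §3′ Composition on the other side: `β ∘ Δ_*(v) = p₁^*v · β` -/

section CompLeft

variable {X Z : ComplexTorusCat} {gX gXX gZ gXZ gT : ℕ} (eX : Fin (2 * gX) ≃ X.toIsog.ι) (eXX : Fin (2 * gXX) ≃ (prodObj X X).toIsog.ι)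
  (eZ : Fin (2 * gZ) ≃ Z.toIsog.ι) (eXZ : Fin (2 * gXZ) ≃ (prodObj X Z).toIsog.ι) (eT : Fin (2 * gT) ≃ (prodObj X (prodObj X Z)).toIsog.ι)
  (eA : Fin (2 * gT) ≃ (prodObj (prodObj X X) Z).toIsog.ι) (hM : 2 * gX + 2 * gZ = 2 * gXZ) (hM' : 2 * gXX + 2 * gZ = 2 * gT) (hgX : gX + gX = 2 * gX)
  (hgXX : gXX + gXX = 2 * gXX) (hgXZ : gXZ + gXZ = 2 * gXZ) (hgT : gT + gT = 2 * gT) {b c c' cb K l l₃ : ℕ} (hcb : c + b = cb) (hK : c' + b = K)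
  (hl : l + 2 * c = 2 * gX) (hl' : l + 2 * c' = 2 * gXX) (h3 : l₃ + 2 * K = 2 * gT) (h3' : l₃ + 2 * cb = 2 * gXZ)

/-- `(Δ_X × 1_Z) ≫ assoc ≫ p₁₃ = 1_{X × Z}` on `X × Z → (X × X) × Z ≅ X × (X × Z)` (`p₁₃ = (p₁, p₂p₂)`). [cite: Fulton1998, §16.1 Prop. 16.1.1 (c) proof (p0294 L26–L29: "Similarly for c (ii)")] -/
theorem prodMap_diagHom_id_comp_prodAssocHom_comp_liftHom_fst_sndsnd (X Z : ComplexTorusCat) :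
    prodMap (diagHom X) (𝟙 Z) ≫ prodAssocHom X X Z ≫ liftHom (fstHom X (prodObj X Z)) (sndHom X (prodObj X Z) ≫ sndHom X Z) = 𝟙 (prodObj X Z) := by
  refine prod_hom_ext ?_ ?_ <;> simp

/-- `(Δ_X × 1_Z) ≫ assoc ≫ p₂₃ = 1_{X × Z}` (`p₂₃ = p₂` on `X × (X × Z)`). [cite: Fulton1998, §16.1 Prop. 16.1.1 (c) proof (p0294 L26–L29: "Similarly for c (ii)")] -/
theorem prodMap_diagHom_id_comp_prodAssocHom_comp_sndHom (X Z : ComplexTorusCat) :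
    prodMap (diagHom X) (𝟙 Z) ≫ prodAssocHom X X Z ≫ sndHom X (prodObj X Z) = 𝟙 (prodObj X Z) := by
  refine prod_hom_ext ?_ ?_ <;> simp

include eZ eA hM hM' in
/-- **`β ∘ Δ_*(v) = p₁^*v · β` for every correspondence `β ∈ Hdgᵇ(X × Z, ℤ)` and `v ∈ Hdgᶜ(X, ℤ)`** — `p₁₃_*(p₁₂^*(Δ_{X*}v) · p₂₃^*β) = p₁^*v · β` in `Hdg^{c+b}(X × Z, ℤ)`
(composite on `X × (X × Z)`): pre-composing with the multiplication correspondence of `v` multiplies by `p₁^*v`. Fulton's argument for `β ∘ Γ_f`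
(Prop. 16.1.1 (c)(ii)) with `γ_f` replaced by `Δ`, run on `(X × X) × Z` through the associator (an isomorphism: `(φ ≫ f)_*(φ^*γ) = f_*γ`, g27-#8):
`p₁^*(Δ_*v) = (Δ × 1_Z)_*(p₁^*v)` (base change, g27-#8 `integralHodgeClassesPushforward_prodMap_id_pullbackHom_fstHom'`), the projection formula for `Δ × 1_Z`
(g27-#2), and `(Δ × 1_Z) ≫ assoc ≫ p₁₃ = (Δ × 1_Z) ≫ assoc ≫ p₂₃ = 1`. [cite: Fulton1998, §16.1 Prop. 16.1.1 (c)(ii) with proof (p0293 L25; p0294 L21–L29) and Example 16.1.14 (ii) (p0302 L14–L20)]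
[cite: Lange2023AbelianVarietiesComplex, §6.2.1 Thm. 6.2.4, Thm. 6.2.5 (p0302) and §6.2.2 (p0303 L40–L42)] -/
theorem integralHodgeClassesCorrComp_pushforward_diagHom_left (v : integralHodgeClasses X.toIsog.Φ c) (β : integralHodgeClasses (prodObj X Z).toIsog.Φ b) :
    integralHodgeClassesPushforward K cb (liftHom (fstHom X (prodObj X Z)) (sndHom X (prodObj X Z) ≫ sndHom X Z)) eT eXZ h3 hgT h3' hgXZ
        (integralHodgeClassesCup (prodObj X (prodObj X Z)).toIsog.Φ hK
          (integralHodgeClassesPullbackHom (liftHom (fstHom X (prodObj X Z)) (sndHom X (prodObj X Z) ≫ fstHom X Z)) c'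
            (integralHodgeClassesPushforward c c' (diagHom X) eX eXX hl hgX hl' hgXX v))
          (integralHodgeClassesPullbackHom (sndHom X (prodObj X Z)) b β)) =
      integralHodgeClassesCup (prodObj X Z).toIsog.Φ hcb (integralHodgeClassesPullbackHom (fstHom X Z) c v) β := by
  haveI : IsIso (prodAssocHom X X Z) := ⟨⟨prodAssocInv X X Z, prodAssocHom_prodAssocInv X X Z, prodAssocInv_prodAssocHom X X Z⟩⟩
  rw [← integralHodgeClassesPushforward_comp_pullbackHom_of_isIso (prodAssocHom X X Z)
      (liftHom (fstHom X (prodObj X Z)) (sndHom X (prodObj X Z) ≫ sndHom X Z)) eA eT eXZ h3 hgT h3' hgXZ,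
    integralHodgeClassesPullbackHom_cup, ← integralHodgeClassesPullbackHom_comp, ← integralHodgeClassesPullbackHom_comp, prodAssocHom_comp_liftHom_fst_sndfst,
    ← integralHodgeClassesPushforward_prodMap_id_pullbackHom_fstHom' (diagHom X) Z eX eXX hl hgX hl' hgXX eZ eXZ eA hM hM'
      (show (l + 2 * gZ) + 2 * c = 2 * gXZ by omega) hgXZ (show (l + 2 * gZ) + 2 * c' = 2 * gT by omega) hgT,
    ← integralHodgeClassesPushforward_cup_pullbackHom (prodMap (diagHom X) (𝟙 Z)) eXZ eA hgXZ hgT hcb hK (show (l + 2 * gZ) + 2 * c = 2 * gXZ by omega)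
      (show (l + 2 * gZ) + 2 * c' = 2 * gT by omega) h3' h3,
    ← integralHodgeClassesPushforward_comp, ← integralHodgeClassesPullbackHom_comp, prodMap_diagHom_id_comp_prodAssocHom_comp_liftHom_fst_sndsnd,
    prodMap_diagHom_id_comp_prodAssocHom_comp_sndHom, integralHodgeClassesPullbackHom_id, integralHodgeClassesPushforward_id]

end CompLeft

/-! ## §4 `Δ_*(w) ∘ Δ_*(u) = Δ_*(u · w)`: `u ↦ Δ_*(u)` is multiplicative -/

section CompDiag

variable (X : ComplexTorusCat) {gX gXX gT : ℕ} (eX : Fin (2 * gX) ≃ X.toIsog.ι) (eXX : Fin (2 * gXX) ≃ (prodObj X X).toIsog.ι)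
  (eT : Fin (2 * gT) ≃ (prodObj X (prodObj X X)).toIsog.ι) (hN : 2 * gX + 2 * gX = 2 * gXX) (hN' : 2 * gX + 2 * gXX = 2 * gT) (hgX : gX + gX = 2 * gX)
  (hgXX : gXX + gXX = 2 * gXX) (hgT : gT + gT = 2 * gT)
  {c c' d d' cd cd' K l m L l₃ : ℕ} (hl : l + 2 * c = 2 * gX) (hl' : l + 2 * c' = 2 * gXX) (hm : m + 2 * d = 2 * gX) (hm' : m + 2 * d' = 2 * gXX)
  (hcd : c + d = cd) (hcd' : c' + d = cd') (hK : c' + d' = K) (hL : L + 2 * cd = 2 * gX) (hL' : L + 2 * cd' = 2 * gXX) (h3 : l₃ + 2 * K = 2 * gT) (h3' : l₃ + 2 * cd' = 2 * gXX)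

include hN hN' hcd' in
/-- **`Δ_*(w) ∘ Δ_*(u) = Δ_*(u · w)` for `u ∈ Hdgᶜ(X, ℤ)`, `w ∈ Hdgᵈ(X, ℤ)`**: the map `u ↦ Δ_*(u)` from the cup-product ring `Hdg•(X, ℤ)` to the ring of correspondences
`(Hdg•(X × X, ℤ), ∘)` is MULTIPLICATIVE (and `Δ_*(1_X) = [Δ_X]` is the unit, g27-#5): §3 with `α = Δ_*u`, then the projection formula `Δ_*u · p₂^*w = Δ_*(u · Δ^*p₂^*w)` and
`Δ ≫ p₂ = 1`. [cite: Fulton1998, §16.1 Cor. 16.1.1 (p0295 L7), Example 16.1.14 (ii) (p0302 L14–L20) and Prop. 8.3 (c) (p0132 L46–L48)]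
[cite: Lange2023AbelianVarietiesComplex, §6.2.1 Thm. 6.2.4 (p0302 L17–L19)] -/
theorem integralHodgeClassesCorrComp_pushforward_diagHom_pushforward_diagHom (u : integralHodgeClasses X.toIsog.Φ c) (w : integralHodgeClasses X.toIsog.Φ d) :
    integralHodgeClassesPushforward K cd' (liftHom (fstHom X (prodObj X X)) (sndHom X (prodObj X X) ≫ sndHom X X)) eT eXX h3 hgT h3' hgXX
        (integralHodgeClassesCup (prodObj X (prodObj X X)).toIsog.Φ hK
          (integralHodgeClassesPullbackHom (liftHom (fstHom X (prodObj X X)) (sndHom X (prodObj X X) ≫ fstHom X X)) c' (integralHodgeClassesPushforward c c' (diagHom X) eX eXX hl hgX hl' hgXX u))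
          (integralHodgeClassesPullbackHom (sndHom X (prodObj X X)) d' (integralHodgeClassesPushforward d d' (diagHom X) eX eXX hm hgX hm' hgXX w))) =
      integralHodgeClassesPushforward cd cd' (diagHom X) eX eXX hL hgX hL' hgXX
        (integralHodgeClassesCup X.toIsog.Φ hcd u w) := by
  rw [integralHodgeClassesCorrComp_pushforward_diagHom_right eX eX eXX eXX eT hN hN' hgX hgXX hgXX hgT hcd' hK hm hm' h3 h3'
      (integralHodgeClassesPushforward c c' (diagHom X) eX eXX hl hgX hl' hgXX u) w,
    ← integralHodgeClassesPushforward_cup_pullbackHom (diagHom X) eX eXX hgX hgXX hcd hcd' hl hl' hL hL' u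
      (integralHodgeClassesPullbackHom (sndHom X X) d w),
    ← integralHodgeClassesPullbackHom_comp, diagHom_sndHom, integralHodgeClassesPullbackHom_id]

end CompDiag

end ComplexTorusCat

end Literature.AlgebraicGeometry.HodgeTheory
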